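import Summits.CriticalPhenomena.PercolationContinuityZ3.Theorems.PercNearOneGluingNoHeavyLowerTailSahiMixtureSingleOrLawPrelim

/-!
# The comb hierarchy for Sahi's `E_k`, LXXIV: **SINGLE-MEMBER H-MIX FOR EVERY `n`, LAW LEVEL** — the hereditary class `𝒦` of an ARBITRARY finite law is
# preserved, Bernstein-positively, under OR-ing an independent coin into ONE event (and AND-ing it into any others)

Support file of the one-cut programme (crux `NoHeavyLowerTail`, stmt-CriticalPhenomena-4575; cell `prim-masterthm`, seat P3, gen 11;
`run/shared/lean/prim/prim-masterthm/prim-masterthm-p3/HIERARCHY.md` §19, memo `run/shared/lean/prim/prim-masterthm/FROM-prim-masterthm-p3-g11-SINGLE-MEMBER-OR.md`).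
The abstract-law version of `…SahiCombMixSingleOrAll/Mixed` (which treat product measures on cubes): `μ ≥ 0` a weight on a finite type `α`, events `A_0,…,A_{n−1}`
with `HereditaryAllOrders μ A` (`𝒦`), an independent coin of bias `h` (`coinWeight μ h` on `α × Bool`) OR-ed into `A_i` and AND-ed into the members `F ∌ i`
(`orAndCoin (A l) (sel i l) (F l)`).  For EVERY row of the ∩-closed family of the mixed events, `h ↦ E_m(μ ⊗ coin(h); slots)` is BERNSTEIN-POSITIVE of degree
`m` — in particular the mixed family is in `𝒦` for every `h ∈ [0,1]`.  Same touched-set recursion as on the cube (`SahiMomentExpansion.sahiE_cons_eq_moment_expansion_aux`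
with the defect indicator `1_{Φ}`, `Φ = {(a,ξ) | a ∈ Q ∖ A_i, ξ = false}`, at the head; `Φ` kills every other active slot); bases: gen 6's AND theorem
`hereditary_andCoin_bernsteinPos` (no OR-touched slot) and the affine cell (one OR-touched slot, nothing else active).
* **`hereditary_orAndCoin_single_bernsteinPos`**, `hereditaryAllOrders_orAndCoin_single`; pure OR: **`hereditaryAllOrders_orCoin_single`** — `(A_0,…,A_{n−1}) ∈ 𝒦`,
  `H` independent ⇒ `(A_0,…,A_i ∪ H,…,A_{n−1}) ∈ 𝒦`, every `n` (the `|F| = 1` rung of H-MIX(n) is TRUE for all `n`; `|F| = 2` is false at `n = 5`,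
  `not_hereditaryMixturePositivity_five`).
HONEST FRAMING: a closure property of the hereditary class; nothing here asserts (M⁺-k) or `C_k` for `k ≥ 3`. [this work]
-/

noncomputable section

open scoped Classical

namespace Summit.CriticalPhenomena.PercolationContinuityZ3.Theorems

open Finset Function
open Literature.Combinatorics.Sahi2008
open Literature.Probability.Percolation.BHK2006 (ind_le_one ind_inter)
open Literature.Probability.Percolation.DecisionTree (ind ind_of_mem ind_of_not_mem ind_nonneg)
open SahiComb
open SahiCombMix (sel orAndCoin finsetProd_ind_eq_ind_biInter ind_empty_fun ex_zero_fun card_filter_succAbove)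
open scoped Nat

namespace SahiMixture

section SingleOrLaw

variable {α : Type*} [Fintype α] (μ : α → ℝ) {n : ℕ} (A : Fin n → Set α) (i : Fin n) (F : Fin n → Bool) (hF : F i = false)

include hF in
/-- **Induction on the number of OR-touched slots (law level).**  `μ ≥ 0` a probability weight; every row of the ∩-closed family of the mixed coin family is
Bernstein-positive of its order in the bias. [this work] -/
theorem bernsteinPos_rowLaw_of_card_le (hμ : ∀ a, 0 ≤ μ a) (hμ1 : ∑ a, μ a = 1) (hA : HereditaryAllOrders μ A) :
    ∀ (o m : ℕ) (K : Fin m → Finset (Fin n)), (univ.filter fun j => i ∈ K j ∧ ∀ l ∈ K j, l ≠ i → F l = false).card ≤ o →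
      BernsteinPos m (fun h => sahiE (coinWeight μ h) m (fun j => ind (⋂ l ∈ K j, orAndCoin (A l) (sel i l) (F l)))) := by
  intro o
  induction o with
  | zero =>
    intro m K hk
    have h0 : ∀ j, i ∈ K j → ∃ l ∈ K j, F l = true := by
      intro j hj
      by_contra hne
      have hall : ∀ l ∈ K j, l ≠ i → F l = false := fun l hl _ => by
        cases hFl : F l
        · rfl
        · exact absurd ⟨l, hl, hFl⟩ hne
      have : j ∈ univ.filter fun j => i ∈ K j ∧ ∀ l ∈ K j, l ≠ i → F l = false := Finset.mem_filter.2 ⟨Finset.mem_univ _, hj, hall⟩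
      rw [Finset.card_eq_zero.1 (Nat.le_zero.1 hk)] at this
      exact Finset.notMem_empty _ this
    have hfam : (fun j => ind (⋂ l ∈ K j, orAndCoin (A l) (sel i l) (F l))) = fun j => ind (⋂ l ∈ (K j).erase i, andCoin (A l) (F l)) := by
      funext j
      congr 1
      by_cases hA' : ∃ l ∈ K j, F l = true
      · rw [slotLaw_and A i F hF (K j) hA']
        obtain ⟨l₀, hl₀, hF₀⟩ := hA'
        have hl₀i : l₀ ≠ i := fun h' => by rw [h', hF] at hF₀; exact Bool.false_ne_true hF₀
        ext z
        simp only [Set.mem_setOf_eq, Set.mem_iInter, andCoin, Finset.mem_erase]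
        constructor
        · rintro ⟨hz, hb⟩ l hl; exact ⟨hz l hl, fun _ => hb⟩
        · intro hz; exact ⟨fun l hl => (hz l hl).1, (hz l₀ ⟨hl₀i, hl₀⟩).2 hF₀⟩
      · have hi : i ∉ K j := fun hi => hA' (h0 j hi)
        have hnoF : ∀ l ∈ K j, l ≠ i → F l = false := fun l hl _ => by
          cases hFl : F l
          · rfl
          · exact absurd ⟨l, hl, hFl⟩ hA'
        rw [slotLaw_plain A i F (K j) hi hnoF, Finset.erase_eq_of_notMem hi]
        ext z
        simp only [Set.mem_setOf_eq, Set.mem_iInter, andCoin]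
        constructor
        · intro hz l hl; exact ⟨hz l hl, fun hFl => absurd hFl (by rw [hnoF l hl (fun h' => hi (h' ▸ hl))]; exact Bool.false_ne_true)⟩
        · intro hz l hl; exact (hz l hl).1
    rw [hfam]
    exact hereditary_andCoin_bernsteinPos A F hA m (fun j => (K j).erase i)
  | succ o ih =>
    intro m K hk
    by_cases hle : (univ.filter fun j => i ∈ K j ∧ ∀ l ∈ K j, l ≠ i → F l = false).card ≤ o
    · exact ih m K hle
    have hcard : (univ.filter fun j => i ∈ K j ∧ ∀ l ∈ K j, l ≠ i → F l = false).card = o + 1 := by omega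
    obtain ⟨x, hx⟩ : ∃ x, x ∈ univ.filter fun j => i ∈ K j ∧ ∀ l ∈ K j, l ≠ i → F l = false := Finset.card_pos.1 (by omega)
    have hxi : i ∈ K x := (Finset.mem_filter.1 hx).2.1
    have hxn : ∀ l ∈ K x, l ≠ i → F l = false := (Finset.mem_filter.1 hx).2.2
    obtain ⟨m', rfl⟩ : ∃ m', m = m' + 1 := ⟨m - 1, (Nat.succ_pred_eq_of_pos (Fin.pos x)).symm⟩
    have hothers : (univ.filter fun y : Fin m' => i ∈ K (x.succAbove y) ∧ ∀ l ∈ K (x.succAbove y), l ≠ i → F l = false).card = o := by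
      have := card_filter_succAbove (fun j => i ∈ K j ∧ ∀ l ∈ K j, l ≠ i → F l = false) x ⟨hxi, hxn⟩
      omega
    set R : Fin (m' + 1) → α × Bool → ℝ := fun j => ind (⋂ l ∈ K j, orAndCoin (A l) (sel i l) (F l)) with hR
    set Q : Set α := ⋂ l ∈ (K x).erase i, A l with hQ
    set Φ : Set (α × Bool) := {y : α × Bool | (y.1 ∈ Q ∧ y.1 ∉ A i) ∧ y.2 = false} with hΦ
    have hslotx : ind (⋂ l ∈ K x, orAndCoin (A l) (sel i l) (F l)) = ind {y : α × Bool | y.1 ∈ Q} - ind Φ :=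
      ind_slotLaw_touched A i F (K x) hxi hxn
    have hRx : ∀ h : ℝ, sahiE (coinWeight μ h) (m' + 1) R
        = sahiE (coinWeight μ h) (m' + 1) (update R x (ind {y : α × Bool | y.1 ∈ Q})) - sahiE (coinWeight μ h) (m' + 1) (update R x (ind Φ)) := by
      intro h
      have hlin := sahiE_update_lin (coinWeight μ h) (m' + 1) R x 1 (-1) (ind {y : α × Bool | y.1 ∈ Q}) (ind Φ)
      rw [show (1 : ℝ) • ind {y : α × Bool | y.1 ∈ Q} + (-1 : ℝ) • ind Φ = ind {y : α × Bool | y.1 ∈ Q} - ind Φ from by funext ω; simp; ring,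
        ← hslotx, update_eq_self] at hlin
      rw [hlin]; ring
    by_cases hact : ∃ y : Fin m', i ∈ K (x.succAbove y) ∨ ∃ l ∈ K (x.succAbove y), F l = true
    · -- another active slot: the recursion
      obtain ⟨y₀, hy₀⟩ := hact
      have hK' : (univ.filter fun j => i ∈ update K x ((K x).erase i) j ∧ ∀ l ∈ update K x ((K x).erase i) j, l ≠ i → F l = false).card ≤ o := by
        have h1 : (univ.filter fun j => i ∈ update K x ((K x).erase i) j ∧ ∀ l ∈ update K x ((K x).erase i) j, l ≠ i → F l = false)
            ⊆ (univ.filter fun j => i ∈ K j ∧ ∀ l ∈ K j, l ≠ i → F l = false).erase x := by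
          intro j hj
          rw [Finset.mem_filter] at hj
          by_cases hjx : j = x
          · subst hjx; rw [update_self] at hj; exact absurd hj.2.1 (Finset.notMem_erase i _)
          · rw [update_of_ne hjx] at hj
            exact Finset.mem_erase.2 ⟨hjx, Finset.mem_filter.2 ⟨Finset.mem_univ _, hj.2⟩⟩
        have := Finset.card_le_card h1
        rw [Finset.card_erase_of_mem hx, hcard] at this
        omega
      have ihQ := ih (m' + 1) (update K x ((K x).erase i)) hK'
      have hupd : (fun j => ind (⋂ l ∈ update K x ((K x).erase i) j, orAndCoin (A l) (sel i l) (F l))) = update R x (ind {y : α × Bool | y.1 ∈ Q}) := by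
        funext j
        by_cases hj : j = x
        · subst hj
          rw [update_self, update_self, slotLaw_plain A i F _ (Finset.notMem_erase i _) (fun l hl hli => hxn l (Finset.mem_of_mem_erase hl) hli)]
        · rw [update_of_ne hj, update_of_ne hj]
      rw [hupd] at ihQ
      have ihT : ∀ T : Finset (Fin m'), BernsteinPos Tᶜ.card
          (fun h => sahiE (coinWeight μ h) Tᶜ.card (fun j => x.removeNth R (Tᶜ.orderEmbOfFin rfl j))) := by
        intro T
        have hle : (univ.filter fun j : Fin Tᶜ.card => i ∈ K (x.succAbove (Tᶜ.orderEmbOfFin rfl j))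
            ∧ ∀ l ∈ K (x.succAbove (Tᶜ.orderEmbOfFin rfl j)), l ≠ i → F l = false).card ≤ o := by
          rw [← hothers]
          exact SahiTotalCumulance.card_filter_comp_le_of_injective
            (fun y : Fin m' => i ∈ K (x.succAbove y) ∧ ∀ l ∈ K (x.succAbove y), l ≠ i → F l = false) _ (Tᶜ.orderEmbOfFin rfl).injective
        exact ih Tᶜ.card (fun j => K (x.succAbove (Tᶜ.orderEmbOfFin rfl j))) hle
      have hterm : ∀ T : Finset (Fin m'), BernsteinPos (m' + 1) (fun h =>
          ((T.card)! : ℝ) * (ex (coinWeight μ h) (ind Φ * ∏ j ∈ T, x.removeNth R j)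
            * sahiE (coinWeight μ h) Tᶜ.card (fun j => x.removeNth R (Tᶜ.orderEmbOfFin rfl j)))) := by
        intro T
        by_cases hT : ∃ y ∈ T, (i ∈ K (x.succAbove y) ∨ ∃ l ∈ K (x.succAbove y), F l = true)
        · refine (bernsteinPos_const (m' + 1) le_rfl).congr fun h _ _ => ?_
          rw [show ex (coinWeight μ h) (ind Φ * ∏ j ∈ T, x.removeNth R j) = 0 from by
            rw [hΦ, hQ, show x.removeNth R = fun j => ind (⋂ l ∈ K (x.succAbove j), orAndCoin (A l) (sel i l) (F l)) from rfl,
              ex_phiLaw_prod μ A i F hF K x T h, if_pos hT]]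
          ring
        · have hc : 0 ≤ ex μ (ind (((⋂ l ∈ (K x).erase i, A l) ∩ ⋂ j ∈ T, ⋂ l ∈ K (x.succAbove j), A l) \ A i)) :=
            ex_nonneg hμ fun a => ind_nonneg _ a
          have hcT : Tᶜ.card ≤ m' := by simpa using Finset.card_le_univ Tᶜ
          refine ((((bernsteinPos_one_sub.smul hc).mul_of_le (ihT T) (by omega))).smul
            (Nat.cast_nonneg _ : (0 : ℝ) ≤ ((T.card)! : ℝ))).congr fun h _ _ => ?_
          rw [show ex (coinWeight μ h) (ind Φ * ∏ j ∈ T, x.removeNth R j)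
              = (1 - h) * ex μ (ind (((⋂ l ∈ (K x).erase i, A l) ∩ ⋂ j ∈ T, ⋂ l ∈ K (x.succAbove j), A l) \ A i)) from by
            rw [hΦ, hQ, show x.removeNth R = fun j => ind (⋂ l ∈ K (x.succAbove j), orAndCoin (A l) (sel i l) (F l)) from rfl,
              ex_phiLaw_prod μ A i F hF K x T h, if_neg hT]]
          ring
      have htop : ∀ h : ℝ, ex (coinWeight μ h) (ind Φ * ∏ j, x.removeNth R j) = 0 := by
        intro h
        rw [hΦ, hQ, show x.removeNth R = fun j => ind (⋂ l ∈ K (x.succAbove j), orAndCoin (A l) (sel i l) (F l)) from rfl,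
          ex_phiLaw_prod μ A i F hF K x univ h, if_pos ⟨y₀, Finset.mem_univ _, hy₀⟩]
      refine (ihQ.add (BernsteinPos.sum (univ.filter fun T : Finset (Fin m') => T ≠ univ) fun T _ => hterm T)).congr fun h _ _ => ?_
      rw [hRx h, SahiMeetTowerAll.sahiE_update_eq_sahiE_cons (coinWeight μ h) m' R x (ind Φ),
        SahiMomentExpansion.sahiE_cons_eq_moment_expansion_aux, htop h]
      simp only [hR, hQ, hΦ]
      ring
    · -- no other active slot: the affine cell
      have hxplain : ∀ j, j ≠ x → i ∉ K j ∧ ∀ l ∈ K j, l ≠ i → F l = false := by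
        intro j hj
        obtain ⟨y, rfl⟩ := Fin.exists_succAbove_eq hj
        refine ⟨fun hi' => hact ⟨y, Or.inl hi'⟩, fun l hl _ => ?_⟩
        cases hFl : F l
        · rfl
        · exact absurd ⟨y, Or.inr ⟨l, hl, hFl⟩⟩ hact
      -- the three plain rows as `μ`-rows
      have hQrow : ∀ h : ℝ, sahiE (coinWeight μ h) (m' + 1) (update R x (ind {y : α × Bool | y.1 ∈ Q}))
          = sahiE μ (m' + 1) (fun j => ind (⋂ l ∈ update K x ((K x).erase i) j, A l)) := by
        intro h
        rw [← sahiE_coinWeight_cyl hμ1 h (m' + 1)]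
        congr 1
        funext j
        by_cases hj : j = x
        · subst hj; rw [update_self, update_self, hQ, ind_cyl]
        · rw [update_of_ne hj, update_of_ne hj, hR]
          show ind (⋂ l ∈ K j, orAndCoin (A l) (sel i l) (F l)) = _
          rw [slotLaw_plain A i F (K j) (hxplain j hj).1 (hxplain j hj).2, ind_cyl]
      have hProw : ∀ h : ℝ, sahiE (coinWeight μ h) (m' + 1) (update R x (ind {y : α × Bool | y.1 ∈ A i ∩ Q}))
          = sahiE μ (m' + 1) (fun j => ind (⋂ l ∈ K j, A l)) := by
        intro h
        rw [← sahiE_coinWeight_cyl hμ1 h (m' + 1)]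
        congr 1
        funext j
        by_cases hj : j = x
        · subst hj
          rw [update_self, hQ, ind_cyl]
          conv_rhs => rw [← Finset.insert_erase hxi, Finset.set_biInter_insert]
        · rw [update_of_ne hj, hR]
          show ind (⋂ l ∈ K j, orAndCoin (A l) (sel i l) (F l)) = _
          rw [slotLaw_plain A i F (K j) (hxplain j hj).1 (hxplain j hj).2, ind_cyl]
      -- the `Φ`-row = (1 − h) × the `(Q ∖ A_i)`-row
      have hmom : ∀ (h : ℝ) (T : Finset (Fin m')), ex (coinWeight μ h) (ind Φ * ∏ j ∈ T, x.removeNth R j)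
          = (1 - h) * ex (coinWeight μ h) (ind {y : α × Bool | y.1 ∈ Q \ A i} * ∏ j ∈ T, x.removeNth R j) := by
        intro h T
        have hnone : ¬ ∃ y ∈ T, (i ∈ K (x.succAbove y) ∨ ∃ l ∈ K (x.succAbove y), F l = true) := by
          rintro ⟨y, _, hy⟩
          exact hact ⟨y, hy⟩
        rw [show x.removeNth R = fun j => ind (⋂ l ∈ K (x.succAbove j), orAndCoin (A l) (sel i l) (F l)) from rfl, hΦ, hQ,
          ex_phiLaw_prod μ A i F hF K x T h, if_neg hnone]
        congr 1
        rw [finsetProd_ind_eq_ind_biInter (fun j => ⋂ l ∈ K (x.succAbove j), orAndCoin (A l) (sel i l) (F l)) T,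
          show (⋂ j ∈ T, ⋂ l ∈ K (x.succAbove j), orAndCoin (A l) (sel i l) (F l))
              = {z : α × Bool | z.1 ∈ ⋂ j ∈ T, ⋂ l ∈ K (x.succAbove j), A l} from by
            rw [show (⋂ j ∈ T, ⋂ l ∈ K (x.succAbove j), orAndCoin (A l) (sel i l) (F l))
                = ⋂ j ∈ T, {z : α × Bool | z.1 ∈ ⋂ l ∈ K (x.succAbove j), A l} from
              Set.iInter_congr fun j => Set.iInter_congr fun _ =>
                slotLaw_plain A i F _ (hxplain _ (Fin.succAbove_ne x j)).1 (hxplain _ (Fin.succAbove_ne x j)).2]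
            ext z; simp only [Set.mem_iInter, Set.mem_setOf_eq],
          show ind {y : α × Bool | y.1 ∈ (⋂ l ∈ (K x).erase i, A l) \ A i} * ind {z : α × Bool | z.1 ∈ ⋂ j ∈ T, ⋂ l ∈ K (x.succAbove j), A l}
              = fun z : α × Bool => ind (((⋂ l ∈ (K x).erase i, A l) ∩ ⋂ j ∈ T, ⋂ l ∈ K (x.succAbove j), A l) \ A i) z.1 from by
            funext z
            rw [Pi.mul_apply, ← ind_inter]
            have hset : ({y : α × Bool | y.1 ∈ (⋂ l ∈ (K x).erase i, A l) \ A i} ∩ {z : α × Bool | z.1 ∈ ⋂ j ∈ T, ⋂ l ∈ K (x.succAbove j), A l})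
                = {w : α × Bool | w.1 ∈ ((⋂ l ∈ (K x).erase i, A l) ∩ ⋂ j ∈ T, ⋂ l ∈ K (x.succAbove j), A l) \ A i} := by
              ext w; simp only [Set.mem_inter_iff, Set.mem_setOf_eq, Set.mem_sdiff]; tauto
            rw [hset, ind_cyl],
          ex_coinWeight]
        ring
      have hΦrow : ∀ h : ℝ, sahiE (coinWeight μ h) (m' + 1) (update R x (ind Φ))
          = (1 - h) * sahiE (coinWeight μ h) (m' + 1) (update R x (ind {y : α × Bool | y.1 ∈ Q \ A i})) := by
        intro h
        rw [SahiMeetTowerAll.sahiE_update_eq_sahiE_cons, SahiMeetTowerAll.sahiE_update_eq_sahiE_cons,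
          SahiMomentExpansion.sahiE_cons_eq_moment_expansion_aux, SahiMomentExpansion.sahiE_cons_eq_moment_expansion_aux]
        simp_rw [hmom h]
        rw [mul_sub, Finset.mul_sum]
        congr 1
        · ring
        · exact Finset.sum_congr rfl fun T _ => by ring
      have hDrow : ∀ h : ℝ, sahiE (coinWeight μ h) (m' + 1) (update R x (ind {y : α × Bool | y.1 ∈ Q \ A i}))
          = sahiE (coinWeight μ h) (m' + 1) (update R x (ind {y : α × Bool | y.1 ∈ Q}))
            - sahiE (coinWeight μ h) (m' + 1) (update R x (ind {y : α × Bool | y.1 ∈ A i ∩ Q})) := by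
        intro h
        rw [show ind {y : α × Bool | y.1 ∈ Q \ A i} = (1 : ℝ) • ind {y : α × Bool | y.1 ∈ Q} + (-1 : ℝ) • ind {y : α × Bool | y.1 ∈ A i ∩ Q} from by
            funext z
            simp only [Pi.add_apply, Pi.smul_apply, smul_eq_mul, one_mul, neg_one_mul]
            rw [ind_cyl, ind_cyl, ind_cyl]
            show ind (Q \ A i) z.1 = ind Q z.1 + -ind (A i ∩ Q) z.1
            by_cases h1 : z.1 ∈ Q <;> by_cases h2 : z.1 ∈ A i
            · rw [ind_of_not_mem (show z.1 ∉ Q \ A i from fun h' => h'.2 h2), ind_of_mem h1, ind_of_mem (show z.1 ∈ A i ∩ Q from ⟨h2, h1⟩)]; ring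
            · rw [ind_of_mem (show z.1 ∈ Q \ A i from ⟨h1, h2⟩), ind_of_mem h1, ind_of_not_mem (show z.1 ∉ A i ∩ Q from fun h' => h2 h'.1)]; ring
            · rw [ind_of_not_mem (show z.1 ∉ Q \ A i from fun h' => h1 h'.1), ind_of_not_mem h1, ind_of_not_mem (show z.1 ∉ A i ∩ Q from fun h' => h1 h'.2)]; ring
            · rw [ind_of_not_mem (show z.1 ∉ Q \ A i from fun h' => h1 h'.1), ind_of_not_mem h1, ind_of_not_mem (show z.1 ∉ A i ∩ Q from fun h' => h1 h'.2)]; ring,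
          sahiE_update_lin]
        ring
      have hcQ : 0 ≤ sahiE μ (m' + 1) (fun j => ind (⋂ l ∈ update K x ((K x).erase i) j, A l)) := hA _ _
      have hcP : 0 ≤ sahiE μ (m' + 1) (fun j => ind (⋂ l ∈ K j, A l)) := hA _ _
      refine (((bernsteinPos_id.smul hcQ).add (bernsteinPos_one_sub.smul hcP)).mono (by omega : 1 ≤ m' + 1)).congr fun h _ _ => ?_
      rw [hRx h, hΦrow h, hDrow h, hQrow h, hProw h]
      ring

include hF in
/-- **SINGLE-MEMBER H-MIX FOR EVERY `n` (law level).**  For a probability weight `μ` on a finite type and `(A_0,…,A_{n−1}) ∈ 𝒦` (`HereditaryAllOrders μ A`): OR-ing an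
independent coin of bias `h` into `A_i` and AND-ing it into the members `F ∌ i` gives a family EVERY row of whose ∩-closed family is Bernstein-positive in `h`. [this work] -/
theorem hereditary_orAndCoin_single_bernsteinPos (hμ : ∀ a, 0 ≤ μ a) (hμ1 : ∑ a, μ a = 1) (hA : HereditaryAllOrders μ A)
    (m : ℕ) (K : Fin m → Finset (Fin n)) :
    BernsteinPos m (fun h => sahiE (coinWeight μ h) m (fun j => ind (⋂ l ∈ K j, orAndCoin (A l) (sel i l) (F l)))) :=
  bernsteinPos_rowLaw_of_card_le μ A i F hF hμ hμ1 hA _ m K le_rfl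

include hF in
/-- Hence the mixed family is in `𝒦` for every bias `h ∈ [0,1]`. [this work] -/
theorem hereditaryAllOrders_orAndCoin_single (hμ : ∀ a, 0 ≤ μ a) (hμ1 : ∑ a, μ a = 1) (hA : HereditaryAllOrders μ A)
    {h : ℝ} (h0 : 0 ≤ h) (h1 : h ≤ 1) :
    HereditaryAllOrders (coinWeight μ h) (fun l => orAndCoin (A l) (sel i l) (F l)) :=
  fun m K => (hereditary_orAndCoin_single_bernsteinPos μ A i F hF hμ hμ1 hA m K).nonneg h0 h1

/-- **`𝒦` is closed under OR-ing an independent coin into ONE event** (`F ≡ false`): `(A_0,…,A_{n−1}) ∈ 𝒦`, `H` independent ⇒ `(A_0,…,A_i ∪ H,…,A_{n−1}) ∈ 𝒦`,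
every `n`. [this work] -/
theorem hereditaryAllOrders_orCoin_single (hμ : ∀ a, 0 ≤ μ a) (hμ1 : ∑ a, μ a = 1) (hA : HereditaryAllOrders μ A)
    {h : ℝ} (h0 : 0 ≤ h) (h1 : h ≤ 1) :
    HereditaryAllOrders (coinWeight μ h) (fun l => orCoin (A l) (sel i l)) := by
  have e : (fun l => orCoin (A l) (sel i l)) = fun l => orAndCoin (A l) (sel i l) ((fun _ => false) l) := by
    funext l; unfold SahiCombMix.orAndCoin; cases sel i l <;> rfl
  rw [e]
  exact hereditaryAllOrders_orAndCoin_single μ A i (fun _ => false) rfl hμ hμ1 hA h0 h1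

end SingleOrLaw

end SahiMixture

end Summit.CriticalPhenomena.PercolationContinuityZ3.Theorems

end
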